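import Mathlib.RingTheory.Kaehler.Basic
import Mathlib.FieldTheory.Perfect
import Mathlib.Algebra.CharP.Lemmas
import HarnessLib

/-!
# Absolute Kähler differentials over a perfect base: `Ω[K⁄ℤ] = Ω[K⁄k]`

Two sanity facts behind the tree's use of ABSOLUTE differentials `Ω[K⁄ℤ]` (files
`GaloisCohomology/KatoCohomologyDifferentialForms`, `KatoCohomologyPurityDeRham`, `InverseCartierOperator`)
where the literature (Kato, Bloch–Kato, Gros–Suwa, Shiho) writes `Ω_K = Ω_{K/𝔽_p}` or `Ω_{K/k}` over a perfect
field `k`: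

* `KaehlerDifferential.subsingleton_of_perfectRing` — for a PERFECT ring `k` of characteristic `p`
  (`PerfectRing k p`), `Ω[k⁄R] = 0` for every base `R`: every `a = b^p`, so `da = p b^{p-1} db = 0`;
* `KaehlerDifferential.map_bijective_of_perfectRing` / `KaehlerDifferential.equivOfPerfectBase` — for an
  algebra `K` over a perfect ring `k` of characteristic `p`, the canonical map `Ω[K⁄ℤ] → Ω[K⁄k]` is an
  isomorphism (exact sequence `K ⊗ₖ Ω[k⁄ℤ] → Ω[K⁄ℤ] → Ω[K⁄k] → 0`, `KaehlerDifferential.range_mapBaseChange`,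
  with vanishing first term).

In particular for a field `K` of characteristic `p` (perfect prime field `𝔽_p`, or any perfect `k ⊆ K`):
`Ω[K⁄ℤ] = Ω[K⁄𝔽_p] = Ω[K⁄k]`, so the absolute and the relative differential forms, exterior powers and
de Rham complexes used in those files agree with the printed ones.  Everything is proved; no named fact.
[folklore]
-/

noncomputable section

namespace Literature.NumberTheory.GaloisCohomology

universe u v w

/-- **A perfect ring of characteristic `p` has no Kähler differentials**: `Ω[k⁄R] = 0` for `k` perfect
(`PerfectRing k p`), over any base `R` — every element is a `p`-th power and `d(b^p) = p b^{p-1} db = 0`.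
[folklore] -/
theorem KaehlerDifferential.subsingleton_of_perfectRing (R : Type u) (k : Type v) [CommRing R] [CommRing k]
    [Algebra R k] (p : ℕ) [Fact p.Prime] [CharP k p] [PerfectRing k p] : Subsingleton (Ω[k⁄R]) := by
  have hD : ∀ a : k, KaehlerDifferential.D R k a = 0 := by
    intro a
    obtain ⟨b, rfl⟩ := surjective_frobenius k p a
    rw [frobenius_def, (KaehlerDifferential.D R k).leibniz_pow, ← Nat.cast_smul_eq_nsmul k, CharP.cast_eq_zero,
      zero_smul]
  refine subsingleton_of_forall_eq 0 fun x => ?_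
  have hx : x ∈ Submodule.span k (Set.range (KaehlerDifferential.D R k)) := by
    rw [KaehlerDifferential.span_range_derivation]; trivial
  rw [show Set.range (KaehlerDifferential.D R k) = {0} from
    Set.ext fun y => ⟨fun ⟨a, ha⟩ => ha ▸ hD a, fun hy => ⟨0, by rw [Set.mem_singleton_iff.1 hy, map_zero]⟩⟩,
    Submodule.span_singleton_eq_bot.2 rfl, Submodule.mem_bot] at hx
  exact hx

/-- **Over a perfect base the absolute differentials are the relative ones**: for an algebra `K` over a
perfect ring `k` of characteristic `p`, the canonical `K`-linear map `Ω[K⁄ℤ] → Ω[K⁄k]` is bijective.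
[folklore] -/
theorem KaehlerDifferential.map_bijective_of_perfectRing (k : Type u) (K : Type v) [CommRing k] [CommRing K]
    [Algebra k K] (p : ℕ) [Fact p.Prime] [CharP k p] [PerfectRing k p] :
    Function.Bijective (KaehlerDifferential.map ℤ k K K) := by
  refine ⟨?_, KaehlerDifferential.map_surjective ℤ k K⟩
  haveI := KaehlerDifferential.subsingleton_of_perfectRing ℤ k p
  rw [← LinearMap.ker_eq_bot, ← KaehlerDifferential.range_mapBaseChange ℤ k K, LinearMap.range_eq_bot]
  refine LinearMap.ext fun x => ?_
  rw [LinearMap.zero_apply]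
  induction x using TensorProduct.induction_on with
  | zero => rw [map_zero]
  | tmul a m => rw [Subsingleton.elim m 0, TensorProduct.tmul_zero, map_zero]
  | add x y hx hy => rw [map_add, hx, hy, add_zero]

/-- The isomorphism `Ω[K⁄ℤ] ≃ₗ[K] Ω[K⁄k]` for `K` an algebra over a perfect ring `k` of characteristic `p`
(`D a ↦ D a`). [folklore] -/
def KaehlerDifferential.equivOfPerfectBase (k : Type u) (K : Type v) [CommRing k] [CommRing K] [Algebra k K]
    (p : ℕ) [Fact p.Prime] [CharP k p] [PerfectRing k p] : Ω[K⁄ℤ] ≃ₗ[K] Ω[K⁄k] :=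
  LinearEquiv.ofBijective _ (KaehlerDifferential.map_bijective_of_perfectRing k K p)

/-- `equivOfPerfectBase (D a) = D a`. [folklore] -/
@[simp] theorem KaehlerDifferential.equivOfPerfectBase_D (k : Type u) (K : Type v) [CommRing k] [CommRing K]
    [Algebra k K] (p : ℕ) [Fact p.Prime] [CharP k p] [PerfectRing k p] (a : K) :
    KaehlerDifferential.equivOfPerfectBase k K p (KaehlerDifferential.D ℤ K a) = KaehlerDifferential.D k K a := by
  rw [KaehlerDifferential.equivOfPerfectBase, LinearEquiv.ofBijective_apply, KaehlerDifferential.map_D,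
    Algebra.algebraMap_self_apply]

end Literature.NumberTheory.GaloisCohomology

end
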